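import Mathlib
import HarnessLib
import Literature.Probability.LatticeModels.GinibreCovariance
import Literature.MathematicalPhysics.QuantumFieldTheory.U1GinibreComparison
import Summits.Ventures.LatticeQCDFlow.Scaling.Conjectures

/-!
# LatticeQCDFlow / Scaling — `U(1)`: EVERY TRUNCATED TWO-LOOP CORRELATION OF THE TORUS WILSON
# MEASURE IS NON-NEGATIVE AT EVERY `β ≥ 0` (Ginibre), in every dimension, volume and geometry

HONEST FRAMING: exact (Metropolis-corrected) sampling algorithms for lattice gauge theory;
figures of merit are autocorrelation/cost numbers at stated couplings and volumes; no
continuum-physics claim.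

Venture `LatticeQCDFlow` (cell pub-lqcd), topic `Scaling`, FANOUT row 30 (lean-1) — OUR WORK.  The
venture's volume-law hypotheses (U′) `Conjectures.CrossCutCorrelatorFloor` and (U″)
`Conjectures.ClusteringFloor` ask for a volume-uniform floor under the ABSOLUTE VALUE of the
truncated plaquette–plaquette correlator `⟨P_x P_y⟩ − ⟨P_x⟩⟨P_y⟩` of the torus Wilson measure.  For
the compact abelian gauge group `U(1)` the SIGN is decided at every non-negative coupling by
Ginibre's inequality (`Literature.Probability.LatticeModels.ginibreExpect_mul_reChar_ge`, the
covariance form of [Ginibre 1970, Prop. 3 / Ex. 4], landed with this file): the torus Wilson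
measure of `U(1)` is a Ginibre model on the compact abelian group `U(1)^E` with the plaquette
holonomies as interaction characters and constant couplings `β ≥ 0`
(`wilsonExpectation_u1_eq_ginibreExpect_obs`, every `d`, `L`), so

* **`u1_wilson_reChar_pair_nonneg`** — for ANY two continuous unitary characters `χ₀, χ₁` of the
  configuration group (plaquettes, Wilson loops of any shape, Polyakov loops, products):
  `⟨Re χ₀⟩_β ⟨Re χ₁⟩_β ≤ ⟨Re χ₀ · Re χ₁⟩_β` at every `β ≥ 0`;
* **`u1_truncated_plaquette_pair_nonneg`** — in particular
  `0 ≤ ⟨P_x P_y⟩_β − ⟨P_x⟩_β ⟨P_y⟩_β` for all plaquettes `(x; i, j)`, `(y; k, l)`, every `d`, `L`,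
  `β ≥ 0` — transverse, in-plane, diagonal, adjacent or not;
* `u1_wilson_reChar_mono`, `u1_plaquette_expectation_mono` — Griffiths monotonicity: every loop /
  plaquette expectation of torus `U(1)` is non-decreasing in `β ≥ 0` (the tree's monotone form);
* **`u1_clusteringFloor_iff_signed`**, **`u1_crossCutFloor_iff_signed`** — for `U(1)` at `β ≥ 0`
  the absolute value in (U″)/(U′) is redundant: the items are floors under the truncated correlator
  itself.
Complements lean-1 GEN-11/12 (reflection positivity gives the sign only for the reflection-symmetric
separations) and GEN-13 (`d = 2`: the truncated correlator → 0).  NOT CLAIMED: any floor VALUE;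
non-abelian groups (Ginibre's inequality is abelian); `β < 0`.  Elementary given the Literature
files; nothing is cited as a fact; `def u1Chars`; no `sorry`.
-/

noncomputable section

namespace Summit.Ventures.LatticeQCDFlow.Theory2.U1Ginibre

open MeasureTheory Finset
open Literature.Probability.LatticeModels (reChar ginibreWeight ginibreHamiltonian ginibreExpect
  ginibreExpect_mul_reChar_ge)
open Literature.MathematicalPhysics.QuantumFieldTheory
open Literature.MathematicalPhysics.QuantumLattice (u1Rep continuous_u1Rep)

variable {d L : ℕ}

/-! ## 1. The `U(1)` torus theory as a Ginibre model (every `d`, `L`) -/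

/-- The interaction characters: one plaquette holonomy per torus plaquette. [folklore] -/
def u1Chars (d L : ℕ) (q : Plaquette d L) : GaugeConfig d L Circle →ₜ* Circle :=
  u1PlaqChar q.1 q.2.1.1 q.2.1.2

/-- `e^{−β S(U)} = e^{−β |P|} · e^{∑_q β Re U_q}`. [folklore] -/
theorem exp_neg_mul_wilsonAction_u1_gen [NeZero L] (β : ℝ) (U : GaugeConfig d L Circle) :
    Real.exp (-β * wilsonAction u1Rep U) =
      Real.exp (-β * Fintype.card (Plaquette d L)) * ginibreWeight (u1Chars d L) (fun _ => β) U := by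
  rw [ginibreWeight, ← Real.exp_add]
  congr 1
  have h1 : wilsonAction u1Rep U = Fintype.card (Plaquette d L) -
      ∑ q : Plaquette d L, ((plaquetteHolonomy U q.1 q.2.1.1 q.2.1.2 : Circle) : ℂ).re := by
    simp only [wilsonAction, trace_u1Rep_re, Nat.cast_one, Finset.sum_sub_distrib, Finset.sum_const,
      Finset.card_univ, nsmul_eq_mul, mul_one]
  have h2 : ginibreHamiltonian (u1Chars d L) (fun _ => β) U =
      β * ∑ q : Plaquette d L, ((plaquetteHolonomy U q.1 q.2.1.1 q.2.1.2 : Circle) : ℂ).re := by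
    simp only [ginibreHamiltonian, reChar, u1Chars, u1PlaqChar_apply, ← Finset.mul_sum]
  rw [h1, h2]
  ring

/-- **Every torus Wilson expectation of `U(1)` is a Ginibre expectation** with constant couplings
`β` (any observable, any `d`, `L`). [folklore] -/
theorem wilsonExpectation_u1_eq_ginibreExpect_obs [NeZero L] (β : ℝ)
    (F : GaugeConfig d L Circle → ℝ) :
    wilsonExpectation u1Rep β F =
      ginibreExpect (Measure.pi fun _ : Edge d L => haarProbability Circle) (u1Chars d L)
        (fun _ => β) F := by
  rw [wilsonExpectation_eq_div_integral u1Rep continuous_u1Rep, ginibreExpect]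
  simp_rw [exp_neg_mul_wilsonAction_u1_gen]
  set c := Real.exp (-β * Fintype.card (Plaquette d L))
  have hc : c ≠ 0 := (Real.exp_pos _).ne'
  simp_rw [mul_left_comm _ c, integral_const_mul]
  rw [mul_div_mul_left _ _ hc]

/-- The plaquette observable `Re tr u1Rep(U_p)` is the real part of the plaquette character.
[folklore] -/
theorem u1_plaqObs_eq_reChar (x : Site d L) (i j : Fin d) :
    (fun U : GaugeConfig d L Circle => (u1Rep (plaquetteHolonomy U x i j)).trace.re) =
      reChar (u1PlaqChar x i j) := by
  funext U
  simp [reChar]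

/-! ## 2. Non-negativity of truncated correlations -/

/-- **GINIBRE FOR `U(1)` LATTICE GAUGE THEORY**: for any two continuous unitary characters `χ₀, χ₁`
of the configuration group `U(1)^E` (plaquettes, Wilson or Polyakov loops, their products) and every
`β ≥ 0`: `⟨Re χ₀⟩_β ⟨Re χ₁⟩_β ≤ ⟨Re χ₀ · Re χ₁⟩_β` under the torus Wilson measure, every `d`, `L`.
[folklore] -/
theorem u1_wilson_reChar_pair_nonneg [NeZero L] {β : ℝ} (hβ : 0 ≤ β)
    (χ₀ χ₁ : GaugeConfig d L Circle →ₜ* Circle) :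
    wilsonExpectation u1Rep β (reChar χ₀) * wilsonExpectation u1Rep β (reChar χ₁) ≤
      wilsonExpectation u1Rep β (fun U => reChar χ₀ U * reChar χ₁ U) := by
  simp only [wilsonExpectation_u1_eq_ginibreExpect_obs]
  exact ginibreExpect_mul_reChar_ge _ (fun θ => exists_mul_self_eq_u1Config θ) _ χ₀ χ₁
    (fun _ => hβ)

/-- **THE TRUNCATED PLAQUETTE–PLAQUETTE CORRELATOR OF `U(1)` IS NON-NEGATIVE** at every `β ≥ 0`,
for all plaquettes `(x; i, j)`, `(y; k, l)` of the torus `(ℤ/L)^d` (any relative position).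
[folklore] -/
theorem u1_truncated_plaquette_pair_nonneg [NeZero L] {β : ℝ} (hβ : 0 ≤ β) (x y : Site d L)
    (i j k l : Fin d) :
    0 ≤ wilsonExpectation u1Rep β
          (fun U => (u1Rep (plaquetteHolonomy U x i j)).trace.re *
            (u1Rep (plaquetteHolonomy U y k l)).trace.re) -
        wilsonExpectation u1Rep β (fun U => (u1Rep (plaquetteHolonomy U x i j)).trace.re) *
          wilsonExpectation u1Rep β (fun U => (u1Rep (plaquetteHolonomy U y k l)).trace.re) := by
  have h := u1_wilson_reChar_pair_nonneg (d := d) (L := L) hβ (u1PlaqChar x i j) (u1PlaqChar y k l)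
  rw [u1_plaqObs_eq_reChar, u1_plaqObs_eq_reChar]
  have e : (fun U : GaugeConfig d L Circle => (u1Rep (plaquetteHolonomy U x i j)).trace.re *
      (u1Rep (plaquetteHolonomy U y k l)).trace.re) =
      fun U => reChar (u1PlaqChar x i j) U * reChar (u1PlaqChar y k l) U := by
    funext U; simp [reChar]
  rw [e]
  linarith

/-- **GRIFFITHS MONOTONICITY FOR `U(1)` LATTICE GAUGE THEORY**: for every continuous unitary
character `χ₀` of the configuration group (any Wilson / Polyakov loop, any plaquette) the torus
expectation `⟨Re χ₀⟩_β` is non-decreasing in `β` on `[0, ∞)`, every `d`, `L` (the tree's monotone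
Ginibre inequality `ginibreExpect_reChar_mono` read through `wilsonExpectation_u1_eq_ginibreExpect_obs`).
[folklore] -/
theorem u1_wilson_reChar_mono [NeZero L] {β β' : ℝ} (hβ : 0 ≤ β) (hββ' : β ≤ β')
    (χ₀ : GaugeConfig d L Circle →ₜ* Circle) :
    wilsonExpectation u1Rep β (reChar χ₀) ≤ wilsonExpectation u1Rep β' (reChar χ₀) := by
  simp only [wilsonExpectation_u1_eq_ginibreExpect_obs]
  exact Literature.Probability.LatticeModels.ginibreExpect_reChar_mono _
    (fun θ => exists_mul_self_eq_u1Config θ) _ χ₀ (fun _ => hβ) (fun _ => hββ')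

/-- In particular every plaquette expectation `⟨Re U_p⟩_β` of torus `U(1)` is non-decreasing in
`β ≥ 0`. [folklore] -/
theorem u1_plaquette_expectation_mono [NeZero L] {β β' : ℝ} (hβ : 0 ≤ β) (hββ' : β ≤ β')
    (x : Site d L) (i j : Fin d) :
    wilsonExpectation u1Rep β (fun U => (u1Rep (plaquetteHolonomy U x i j)).trace.re) ≤
      wilsonExpectation u1Rep β' (fun U => (u1Rep (plaquetteHolonomy U x i j)).trace.re) := by
  rw [u1_plaqObs_eq_reChar]
  exact u1_wilson_reChar_mono hβ hββ' _

/-! ## 3. The absolute value in (U′)/(U″) is redundant for `U(1)` at `β ≥ 0` -/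

/-- For `U(1)` at `β ≥ 0`, (U″) `ClusteringFloor` is a floor under the truncated correlator itself
(no absolute value). [folklore] -/
theorem u1_clusteringFloor_iff_signed {β : ℝ} (hβ : 0 ≤ β) (i j a : Fin d) :
    Conjectures.ClusteringFloor d 1 Circle u1Rep β i j a ↔
      ∃ κ₀ : ℝ, 0 < κ₀ ∧ ∃ ξ : ℝ, 0 < ξ ∧ ∃ L₀ : ℕ, ∀ (L : ℕ) [NeZero L], L₀ ≤ L →
        ∀ s : ℕ, 4 * s ≤ L → ∀ x : Site d L,
          κ₀ * Real.exp (-((s : ℝ) / ξ)) ≤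
            wilsonExpectation (d := d) (L := L) u1Rep β
                (fun U => (u1Rep (plaquetteHolonomy U x i j)).trace.re *
                  (u1Rep (plaquetteHolonomy U (x + Pi.single a ((s : ℕ) : ZMod L)) i j)).trace.re) -
              wilsonExpectation (d := d) (L := L) u1Rep β
                  (fun U => (u1Rep (plaquetteHolonomy U x i j)).trace.re) *
                wilsonExpectation (d := d) (L := L) u1Rep β
                  (fun U => (u1Rep (plaquetteHolonomy U (x + Pi.single a ((s : ℕ) : ZMod L))
                    i j)).trace.re) := by
  unfold Conjectures.ClusteringFloor
  refine exists_congr fun κ₀ => and_congr_right fun _ => exists_congr fun ξ =>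
    and_congr_right fun _ => exists_congr fun L₀ => forall_congr' fun L => forall_congr' fun _ =>
    forall_congr' fun _ => forall_congr' fun s => forall_congr' fun _ => forall_congr' fun x => ?_
  rw [abs_of_nonneg (u1_truncated_plaquette_pair_nonneg hβ x _ i j i j)]

/-- For `U(1)` at `β ≥ 0`, (U′) `CrossCutCorrelatorFloor` is a floor under the truncated correlator
itself (no absolute value). [folklore] -/
theorem u1_crossCutFloor_iff_signed {β : ℝ} (hβ : 0 ≤ β) (R : ℕ) (i j a : Fin d) :
    Conjectures.CrossCutCorrelatorFloor d 1 Circle u1Rep β R i j a ↔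
      ∃ δ : ℝ, 0 < δ ∧ ∃ L₀ : ℕ, ∀ (L : ℕ) [NeZero L], L₀ ≤ L → ∀ x : Site d L,
        δ ≤ wilsonExpectation (d := d) (L := L) u1Rep β
                (fun U => (u1Rep (plaquetteHolonomy U x i j)).trace.re *
                  (u1Rep (plaquetteHolonomy U (x + Pi.single a ((2 * R + 1 : ℕ) : ZMod L))
                    i j)).trace.re) -
              wilsonExpectation (d := d) (L := L) u1Rep β
                  (fun U => (u1Rep (plaquetteHolonomy U x i j)).trace.re) *
                wilsonExpectation (d := d) (L := L) u1Rep β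
                  (fun U => (u1Rep (plaquetteHolonomy U (x + Pi.single a ((2 * R + 1 : ℕ) : ZMod L))
                    i j)).trace.re) := by
  unfold Conjectures.CrossCutCorrelatorFloor
  refine exists_congr fun δ => and_congr_right fun _ => exists_congr fun L₀ =>
    forall_congr' fun L => forall_congr' fun _ => forall_congr' fun _ => forall_congr' fun x => ?_
  rw [abs_of_nonneg (u1_truncated_plaquette_pair_nonneg hβ x _ i j i j)]

end Summit.Ventures.LatticeQCDFlow.Theory2.U1Ginibre
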